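import Literature.AnabelianGeometry.EtaleTheta.ThetaCoversTempered

/-!
# [EtTh] Definition 2.5 (i)/(ii) «of type (1, ℤ/lℤ)…» / «(1, μ₂ × ℤ/lℤ)…» — INSTANCE FORMS at the named subgroups

S. Mochizuki, *The étale theta function and its Frobenioid-theoretic manifestations*, Publ. RIMS **45** (2009), Def. 2.5 (i), (ii)
p. 39 [cite: MochizukiEtTh2009, Def 2.5 p.39].

abc-iut cell, D-0079 ORIGINAL-L / L-F [EtTh] (FACT rows F-0608 `TemperedCoverData.OfTypeZMod`, F-0607 `TemperedCoverData.OfTypeMu2ZMod`;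
node `EtTh:Def2.5`), seat abc-iut-w6-d053 (gen 5), companion of the census `LF-ETTH-S1.tsv` (rows F-0608 / F-0607: «no instance theorem at
all»).  PROOF-ONLY (0 definitions, no instance, no new `Prop`), in the currency of abc-iut-L2-t2's `ofTypeLTors_holds` family
(`ThetaCoversOfTypeTempered.lean`, FACT rows F-0592–F-0595): Definition 2.5 says that `X̲` (resp. `X̲̲`, `C̲`, `C̲̲`) is «of type
(1, ℤ/lℤ)» (resp. …) — a predicate on open subgroups of `Π^tp_C` UP TO CONJUGACY; at the construction's OWN subgroups
`Π^tp_{X̲}, Π^tp_{X̲̲}, Π^tp_{C̲}, Π^tp_{C̲̲}` (resp. their intersections with `Π^tp_{Ċ}`) it holds with conjugator `1`, modulo exactly the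
standing conditions `Def25Conditions` of Def. 2.5 (`Π^tp_Ÿ ≤ Π^tp_{X̲}` and the `±`-compatibility of `Π_{X̲̲}`), which print ASSUMES at
that point («suppose that …»).  The universal closures (every open subgroup is of that type) are of course false.
* `TemperedCoverData.ofTypeZMod_of_def25Conditions` — F-0608 at the named subgroup of index `i`, ⟸ `Def25Conditions` only;
* `TemperedCoverData.ofTypeMu2ZMod_of_def25Conditions` — F-0607, idem.
HONEST FRAMING: definition-type rows — true by construction at the chosen covers; refereed pre-IUT material; nothing here bears on
[IUTchIII] Cor. 3.12; no side taken; typed ≠ proved.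
-/

namespace Literature.AnabelianGeometry.EtaleTheta

namespace ThetaCovers.TemperedCoverData

variable {l : ℕ} (T : TemperedCoverData l) (IsPmCompatible : Subgroup T.PiC → Prop)

/-- **F-0608 [EtTh] Def. 2.5 (i) at the named subgroups**: under `Def25Conditions`, the `i`-th of `Π^tp_{X̲}, Π^tp_{X̲̲}, Π^tp_{C̲}, Π^tp_{C̲̲}`
is of type `(1, ℤ/lℤ)` (resp. `(1, (ℤ/lℤ)^Θ)`, `(1, ℤ/lℤ)±`, `(1, (ℤ/lℤ)^Θ)±`) — conjugator `c := 1`. [cite: MochizukiEtTh2009, Def 2.5 p.39] -/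
theorem ofTypeZMod_of_def25Conditions (h : T.Def25Conditions IsPmCompatible) (i : Fin 4) :
    T.OfTypeZMod IsPmCompatible i ([T.tp T.PiXu, T.tp T.PiXuu, T.tp T.PiCu, T.tp T.PiCuu].get i) :=
  ⟨h, 1, by ext x; simp⟩

/-- **F-0607 [EtTh] Def. 2.5 (ii) at the named subgroups**: under `Def25Conditions`, the `i`-th of the dotted composites
`Π^tp_{X̲} ∩ Π^tp_{Ċ}, Π^tp_{X̲̲} ∩ Π^tp_{Ċ}, Π^tp_{C̲} ∩ Π^tp_{Ċ}, Π^tp_{C̲̲} ∩ Π^tp_{Ċ}` is of type `(1, μ₂ × ℤ/lℤ)` (resp. …) —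
conjugator `c := 1`. [cite: MochizukiEtTh2009, Def 2.5 p.39] -/
theorem ofTypeMu2ZMod_of_def25Conditions (h : T.Def25Conditions IsPmCompatible) (i : Fin 4) :
    T.OfTypeMu2ZMod IsPmCompatible i
      ([T.tp T.PiXu ⊓ T.PiCdot, T.tp T.PiXuu ⊓ T.PiCdot, T.tp T.PiCu ⊓ T.PiCdot, T.tp T.PiCuu ⊓ T.PiCdot].get i) :=
  ⟨h, 1, by ext x; simp⟩

end ThetaCovers.TemperedCoverData

end Literature.AnabelianGeometry.EtaleTheta
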